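import Literature.Topology.FourManifolds.BandSumJunctionCoords
import Literature.Topology.FourManifolds.KnotsProofs
import HarnessLib

/-!
# Band sums at the attaching points, III: the other three attaching points by symmetry

Fact seat `provefact-Literature.Topology.FourManifolds.BandData.isIsotopic_of_band_eq`; sequel of
`BandSumJunction.lean`, `BandSumJunctionCoords.lean`, which analyse the attaching point
`A = (0, -δ)` (where `K` enters the lower arc from `K₁`). The remaining attaching points
`B = (1, -δ)` (where `K` leaves the lower arc along `K₂`), `B' = (1, 1 + δ)` (enters the upper arc
from `K₂`) and `A' = (0, 1 + δ)` (leaves it along `K₁`) are reduced to `A` by two symmetries of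
band-sum data, and the local results at `A` are read back through them. Everything here is proved;
no named facts are introduced.

* `mirrorX`, `mirrorXLin` (§ mirror): the mirror `(x₀, x₁) ↦ (1 - x₀, x₁)` of the square and its
  linear part; an involutive isometry preserving every `squareNhd δ`.
* `Knot.reverse_apply_circlePoint'`, `Knot.deriv_coe_reverse_circlePoint`: the reversed knot
  `K.reverse = K ∘ reflectLast 1` (tree: `Knots.lean`, `KnotsProofs.lean`) along the
  `2π`-periodic parametrisation: `K.reverse (circlePoint θ) = K (circlePoint (-θ))`, velocity
  `-(K ∘ circlePoint)' (-θ)`. (`Knot.reverse_apply_circlePoint'` restates `Knot.reverse_apply_circlePoint` of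
  `LinkingNumberReverseProofs.lean`, whose import chain is avoided here, and is proved through the
  tree's `circleConj_circlePoint` of `CircleDiffeotopy.lean`.)
* `BandData.reverseMirror : BandData K₂.reverse K₁.reverse K.reverse avoid` — **reversing all
  three knots and mirroring the square gives band-sum data again**: band `band ∘ mirrorX`, arcs
  `s ↦ mirrorX (lowerArc (1 - s))`, `s ↦ mirrorX (upperArc (1 - s))`; the orientation clauses
  follow from those of `b` by the chain rule (`fderiv_coe_band_mirrorX`, `D mirrorX = diag(-1, 1)`).
  Its attaching point `A` is `B` of `b`.
* `BandData.halfTurn (hdisj) : BandData K₂ K₁ K avoid` — explicit form of the tree's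
  `BandData.exists_halfTurn` (`BandSumCommProofs.lean`; same construction): band
  `x ↦ band ((1, 1) - x)`, arcs the half-turned arcs in the other order. Its attaching points
  `A`, `B` are `B'`, `A'` of `b`.
* `PatchThickening.precomp` / `halfTurn` / `mirror` (§ thickenings): a thickening of `β` gives
  one of `β ∘ A` for a smooth involution `A` preserving the collar squares (same `emb`,
  parametrisation `A ∘ param`); its planar coordinate is `A ∘ planar` (`planar_precomp`).
* § other attaching points: `exists_radius_planar_one_lt_right` (near `p' = band B`, points of `K`
  off the band surface project to `{x₁ < -δ}`), `exists_flat_graph_lowerArc_right` (near `B` the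
  lower arc is the graph `x₀ = 1 - g (x₁)`, `g` smooth vanishing on `(-∞, -δ]`),
  `exists_radius_planar_one_gt_upperRight/upperLeft` (near `q' = band B'`, `q = band A'`, points
  of `K` off the band surface project to `{x₁ > 1 + δ}`). The flat graph germs of the upper arc
  at `B'`, `A'` are those of the lower arc of `b.halfTurn` at `A`, `B`, available through the
  previous lemmas applied to `b.halfTurn` with `T.halfTurn` (`halfTurn_lowerCurve`,
  `halfTurn_lowerArc_image`).

## References

* D. Rolfsen, *Knots and Links* (1976), §3.C (reverse and obverse of a knot). [Rolfsen1976]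
* P. R. Cromwell, *Knots and Links* (2004), §4.6 (product of oriented knots along a rectangle).
  [Cromwell2004]

## Design notes

* `refactor:` note for the librarian: `BandData.halfTurn` repeats the body of the tree's existential
  `BandData.exists_halfTurn` (`BandSumCommProofs.lean`); moving `halfTurn` there would reduce
  `exists_halfTurn` to `⟨b.halfTurn hdisj, rfl, rfl⟩`.
* `Knot.reverse` needs the instance `SphereEmbedding.smoothnessFacts` of `KnotsProofs.lean`, hence
  that import.
* The symmetric data are `def`s with definitional `band`, `δ`, arcs (`@[simp]` projections), so that
  `T.mirror : PatchThickening (b.band ∘ mirrorX) δ₀ δ₁` is accepted where a thickening of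
  `b.reverseMirror.band` is expected, and planar coordinates are read back by `rfl`.
* Local notation `𝔼 n`, `𝕊 n` follows the directory pattern. Nothing here uses `sorry`.
-/

open scoped Manifold ContDiff Topology Real RealInnerProductSpace
open Function Set Metric Filter

noncomputable section

namespace Literature.Topology.FourManifolds

/-- Local notation: `𝔼 n` is the model Euclidean space `EuclideanSpace ℝ (Fin n)`. -/
local notation "𝔼 " n:arg => EuclideanSpace ℝ (Fin n)

/-- Local notation: `𝕊 n` is the unit sphere in `EuclideanSpace ℝ (Fin (n + 1))`. -/
local notation "𝕊 " n:arg => (Metric.sphere (0 : EuclideanSpace ℝ (Fin (n + 1))) 1)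

/-! ## The mirror `(x₀, x₁) ↦ (1 - x₀, x₁)` of the square -/

/-- The linear part of the mirror: `(v₀, v₁) ↦ (-v₀, v₁)`. [folklore] -/
def mirrorXLin : 𝔼 2 →L[ℝ] 𝔼 2 :=
  LinearMap.toContinuousLinearMap
    { toFun := fun v ↦ pt2 (-v 0) (v 1)
      map_add' := fun v w ↦ by
        ext i; fin_cases i
        · simp [pt2]; ring
        · simp [pt2]
      map_smul' := fun c v ↦ by ext i; fin_cases i <;> simp [pt2] }

/-- The linear mirror in coordinates. [folklore] -/
@[simp]
theorem mirrorXLin_apply (v : 𝔼 2) : mirrorXLin v = pt2 (-v 0) (v 1) := rfl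

/-- The **mirror** of the plane in the vertical line `x₀ = 1/2`: `(x₀, x₁) ↦ (1 - x₀, x₁)`. It
exchanges the two edge lines of the square and reverses the direction of the lower and upper
arcs. [folklore] -/
def mirrorX (x : 𝔼 2) : 𝔼 2 := pt2 (1 - x 0) (x 1)

/-- The mirror in coordinates. [folklore] -/
@[simp]
theorem mirrorX_apply_zero (x : 𝔼 2) : mirrorX x 0 = 1 - x 0 := rfl

/-- The mirror in coordinates. [folklore] -/
@[simp]
theorem mirrorX_apply_one (x : 𝔼 2) : mirrorX x 1 = x 1 := rfl

/-- The mirror on named points. [folklore] -/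
@[simp]
theorem mirrorX_pt2 (a c : ℝ) : mirrorX (pt2 a c) = pt2 (1 - a) c := rfl

/-- The mirror is an involution. [folklore] -/
@[simp]
theorem mirrorX_mirrorX (x : 𝔼 2) : mirrorX (mirrorX x) = x := by
  ext i; fin_cases i <;> simp [mirrorX, pt2]

/-- The mirror is an involution. [folklore] -/
theorem involutive_mirrorX : Involutive mirrorX := mirrorX_mirrorX

/-- The mirror is injective. [folklore] -/
theorem injective_mirrorX : Injective mirrorX := involutive_mirrorX.injective

/-- The mirror is affine: `mirrorX x = mirrorXLin x + (1, 0)`. [folklore] -/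
theorem mirrorX_eq (x : 𝔼 2) : mirrorX x = mirrorXLin x + pt2 1 0 := by
  ext i; fin_cases i
  · simp [mirrorX, pt2]; ring
  · simp [mirrorX, pt2]

/-- The mirror is smooth. [folklore] -/
theorem contDiff_mirrorX : ContDiff ℝ ∞ mirrorX := by
  rw [show mirrorX = fun x ↦ mirrorXLin x + pt2 1 0 from funext mirrorX_eq]
  exact mirrorXLin.contDiff.add contDiff_const

/-- The derivative of the mirror is its linear part. [folklore] -/
theorem hasFDerivAt_mirrorX (x : 𝔼 2) : HasFDerivAt mirrorX mirrorXLin x := by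
  rw [show mirrorX = fun x ↦ mirrorXLin x + pt2 1 0 from funext mirrorX_eq]
  exact mirrorXLin.hasFDerivAt.add_const _

/-- The derivative of the mirror is its linear part. [folklore] -/
theorem fderiv_mirrorX (x : 𝔼 2) : fderiv ℝ mirrorX x = mirrorXLin :=
  (hasFDerivAt_mirrorX x).fderiv

/-- The linear mirror is an involution. [folklore] -/
@[simp]
theorem mirrorXLin_mirrorXLin (v : 𝔼 2) : mirrorXLin (mirrorXLin v) = v := by
  ext i; fin_cases i <;> simp [pt2]

/-- The linear mirror is injective. [folklore] -/
theorem injective_mirrorXLin : Injective mirrorXLin :=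
  Function.Involutive.injective mirrorXLin_mirrorXLin

/-- The mirror preserves the square neighbourhood. [folklore] -/
theorem mirrorX_mem_squareNhd_iff {δ : ℝ} {x : 𝔼 2} : mirrorX x ∈ squareNhd δ ↔ x ∈ squareNhd δ := by
  simp only [mem_squareNhd_iff, Fin.forall_fin_two, mirrorX_apply_zero, mirrorX_apply_one, mem_Ioo]
  constructor
  · rintro ⟨⟨h1, h2⟩, h3⟩; exact ⟨⟨by linarith, by linarith⟩, h3⟩
  · rintro ⟨⟨h1, h2⟩, h3⟩; exact ⟨⟨by linarith, by linarith⟩, h3⟩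

/-- The mirror maps the square neighbourhood onto itself. [folklore] -/
theorem image_mirrorX_squareNhd (δ : ℝ) : mirrorX '' squareNhd δ = squareNhd δ := by
  ext x
  constructor
  · rintro ⟨y, hy, rfl⟩
    exact mirrorX_mem_squareNhd_iff.2 hy
  · intro hx
    exact ⟨mirrorX x, mirrorX_mem_squareNhd_iff.2 hx, mirrorX_mirrorX x⟩

/-- Membership in the image of a mirrored, reversed planar curve over a set symmetric under
`s ↦ 1 - s`. [folklore] -/
theorem mem_image_mirrorX_comp_iff {γ : ℝ → 𝔼 2} {s : Set ℝ} (hs : ∀ t, t ∈ s ↔ 1 - t ∈ s)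
    {x : 𝔼 2} : x ∈ (fun t ↦ mirrorX (γ (1 - t))) '' s ↔ mirrorX x ∈ γ '' s := by
  constructor
  · rintro ⟨t, ht, rfl⟩
    exact ⟨1 - t, (hs t).1 ht, (mirrorX_mirrorX _).symm⟩
  · rintro ⟨t, ht, h⟩
    refine ⟨1 - t, (hs t).1 ht, ?_⟩
    show mirrorX (γ (1 - (1 - t))) = x
    rw [sub_sub_cancel, h, mirrorX_mirrorX]

/-! ## Reversed knots along the `2π`-periodic parametrisation -/

namespace Knot

/-- The reversed knot along the `2π`-periodic parametrisation: `K.reverse (circlePoint θ) =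
K (circlePoint (-θ))` (local restatement of `Knot.reverse_apply_circlePoint` of
`LinkingNumberReverseProofs.lean`, whose import chain is avoided here; proved through the tree's
`circleConj_circlePoint`, `CircleDiffeotopy.lean`). [folklore] -/
theorem reverse_apply_circlePoint' (K : Knot) (θ : ℝ) :
    (K.reverse : Knot) (circlePoint θ) = K (circlePoint (-θ)) := by
  show K (reflectLast 1 (circlePoint θ)) = _
  rw [← coe_circleConj_eq_reflectLast, circleConj_circlePoint]

/-- The velocity of the reversed knot (read in `ℝ⁴`): `(K.reverse ∘ circlePoint)' θ =
-(K ∘ circlePoint)' (-θ)`. [folklore] -/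
theorem deriv_coe_reverse_circlePoint (K : Knot) (θ : ℝ) :
    deriv (fun t ↦ (((K.reverse : Knot) (circlePoint t) : 𝕊 3) : 𝔼 4)) θ =
      -deriv (fun t ↦ ((K (circlePoint t) : 𝕊 3) : 𝔼 4)) (-θ) := by
  simp_rw [reverse_apply_circlePoint']
  exact deriv_comp_neg (fun t ↦ ((K (circlePoint t) : 𝕊 3) : 𝔼 4)) θ

end Knot


/-! ## The reverse–mirror of band-sum data -/

namespace BandData

variable {K₁ K₂ K : Knot} {avoid : Set (𝕊 3)} (b : BandData K₁ K₂ K avoid)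

/-- **Chain rule for the mirrored band** (read in `ℝ⁴`): the derivative of `x ↦ band (mirrorX x)`
at `x` in the direction `v` is the derivative of `band` at `mirrorX x` in the direction
`mirrorXLin v`. [folklore] -/
theorem fderiv_coe_band_mirrorX (x v : 𝔼 2) :
    fderiv ℝ (fun x ↦ (b.band (mirrorX x) : 𝔼 4)) x v =
      fderiv ℝ (fun x ↦ (b.band x : 𝔼 4)) (mirrorX x) (mirrorXLin v) := by
  have hd : DifferentiableAt ℝ (fun x ↦ (b.band x : 𝔼 4)) (mirrorX x) :=
    b.contDiff_coe_band.differentiable (by simp) _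
  have hρ : DifferentiableAt ℝ mirrorX x := (hasFDerivAt_mirrorX x).differentiableAt
  rw [show (fun x ↦ (b.band (mirrorX x) : 𝔼 4)) = (fun x ↦ (b.band x : 𝔼 4)) ∘ mirrorX from rfl,
    fderiv_comp x hd hρ, fderiv_mirrorX]
  rfl

/-- Membership in a preimage under the mirrored band, inside the square. [folklore] -/
theorem mirrorX_preimage_inter {S : Set (𝕊 3)} {P : 𝔼 2 → Prop}
    (h : b.band ⁻¹' S ∩ squareNhd b.δ = {x ∈ squareNhd b.δ | P x}) :
    (fun x ↦ b.band (mirrorX x)) ⁻¹' S ∩ squareNhd b.δ = {x ∈ squareNhd b.δ | P (mirrorX x)} := by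
  ext x
  have hx := Set.ext_iff.mp h (mirrorX x)
  simp only [mem_inter_iff, mem_preimage, mem_setOf_eq, mirrorX_mem_squareNhd_iff] at hx ⊢
  exact hx

/-- Derivative of a reversed, mirrored planar curve. [folklore] -/
theorem _root_.Literature.Topology.FourManifolds.deriv_mirrorX_comp_one_sub {γ : ℝ → 𝔼 2}
    (hγ : ContDiff ℝ ∞ γ) (s : ℝ) :
    deriv (fun t ↦ mirrorX (γ (1 - t))) s = -mirrorXLin (deriv γ (1 - s)) := by
  have hγ' : HasDerivAt γ (deriv γ (1 - s)) (1 - s) :=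
    ((hγ.differentiable (by simp)) _).hasDerivAt
  have h1 : HasDerivAt (fun t ↦ γ (1 - t)) (-deriv γ (1 - s)) s := hγ'.comp_const_sub 1 s
  have h2 : HasDerivAt (mirrorX ∘ fun t ↦ γ (1 - t)) (mirrorXLin (-deriv γ (1 - s))) s :=
    (hasFDerivAt_mirrorX (γ (1 - s))).comp_hasDerivAt s h1
  rw [show (fun t ↦ mirrorX (γ (1 - t))) = mirrorX ∘ fun t ↦ γ (1 - t) from rfl, h2.deriv, map_neg]

/-- **The reverse–mirror of band-sum data.** If `K` is the band sum of `K₁`, `K₂` along `band`,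
then the reversed knot `K.reverse` is the band sum of `K₂.reverse`, `K₁.reverse` along the band
precomposed with the mirror `(x₀, x₁) ↦ (1 - x₀, x₁)` (same collar width): the mirror exchanges the
two edge lines, and reversing the knots restores the required orientations along them
(`orient_left` from `orient_right` and vice versa, by the chain rule with `D(mirrorX) = diag(-1, 1)`
and `(K.reverse ∘ circlePoint)' θ = -(K ∘ circlePoint)' (-θ)`); the new planar arcs are the
mirrored old ones traversed backwards (`s ↦ mirrorX (lowerArc (1 - s))`), along which `K.reverse`
runs left to right. Rolfsen (1976), §3.C (reverse of a knot); Cromwell (2004), §4.6. [folklore] -/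
def reverseMirror : BandData K₂.reverse K₁.reverse K.reverse avoid where
  band x := b.band (mirrorX x)
  δ := b.δ
  δ_pos := b.δ_pos
  contMDiff := b.contMDiff.comp contDiff_mirrorX.contMDiff
  injOn x hx y hy h := injective_mirrorX
    (b.injOn (mirrorX_mem_squareNhd_iff.2 hx) (mirrorX_mem_squareNhd_iff.2 hy) h)
  injective_mfderiv x hx := by
    have hn : (∞ : ℕ∞ω) ≠ 0 := by simp
    have hb : MDifferentiableAt 𝓘(ℝ, 𝔼 2) (𝓡 3) b.band (mirrorX x) :=
      b.contMDiff.mdifferentiableAt hn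
    have hρ : MDifferentiableAt 𝓘(ℝ, 𝔼 2) 𝓘(ℝ, 𝔼 2) mirrorX x :=
      contDiff_mirrorX.contMDiff.mdifferentiableAt hn
    rw [show (fun x ↦ b.band (mirrorX x)) = b.band ∘ mirrorX from rfl, mfderiv_comp x hb hρ,
      mfderiv_eq_fderiv, fderiv_mirrorX]
    intro v w hvw
    simp only [ContinuousLinearMap.comp_apply] at hvw
    exact injective_mirrorXLin (b.injective_mfderiv _ (mirrorX_mem_squareNhd_iff.2 hx) hvw)
  disjoint_avoid := by
    rw [show (fun x ↦ b.band (mirrorX x)) = b.band ∘ mirrorX from rfl, image_comp,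
      image_mirrorX_squareNhd]
    exact b.disjoint_avoid
  preimage_left := by
    rw [Knot.range_reverse, b.mirrorX_preimage_inter b.preimage_right]
    ext x
    simp only [mem_setOf_eq, mirrorX_apply_zero]
    exact and_congr_right fun _ ↦ ⟨fun h ↦ by linarith, fun h ↦ by linarith⟩
  preimage_right := by
    rw [Knot.range_reverse, b.mirrorX_preimage_inter b.preimage_left]
    ext x
    simp only [mem_setOf_eq, mirrorX_apply_zero]
    exact and_congr_right fun _ ↦ ⟨fun h ↦ by linarith, fun h ↦ by linarith⟩
  range_diff := by
    rw [show (fun x ↦ b.band (mirrorX x)) = b.band ∘ mirrorX from rfl, image_comp,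
      image_mirrorX_squareNhd, Knot.range_reverse, Knot.range_reverse, Knot.range_reverse,
      b.range_diff, union_comm]
  lowerArc s := mirrorX (b.lowerArc (1 - s))
  upperArc s := mirrorX (b.upperArc (1 - s))
  contDiff_lowerArc := contDiff_mirrorX.comp (b.contDiff_lowerArc.comp (contDiff_const.sub contDiff_id))
  contDiff_upperArc := contDiff_mirrorX.comp (b.contDiff_upperArc.comp (contDiff_const.sub contDiff_id))
  injOn_lowerArc s hs t ht h := by
    have := b.injOn_lowerArc (Set.Ioo.mem_iff_one_sub_mem.1 hs) (Set.Ioo.mem_iff_one_sub_mem.1 ht)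
      (injective_mirrorX h)
    linarith
  injOn_upperArc s hs t ht h := by
    have := b.injOn_upperArc (Set.Ioo.mem_iff_one_sub_mem.1 hs) (Set.Ioo.mem_iff_one_sub_mem.1 ht)
      (injective_mirrorX h)
    linarith
  deriv_lowerArc_ne_zero t ht := by
    rw [deriv_mirrorX_comp_one_sub b.contDiff_lowerArc, neg_ne_zero]
    exact fun h ↦ b.deriv_lowerArc_ne_zero _ (Set.Ioo.mem_iff_one_sub_mem.1 ht)
      (injective_mirrorXLin (h.trans (map_zero _).symm))
  deriv_upperArc_ne_zero t ht := by
    rw [deriv_mirrorX_comp_one_sub b.contDiff_upperArc, neg_ne_zero]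
    exact fun h ↦ b.deriv_upperArc_ne_zero _ (Set.Ioo.mem_iff_one_sub_mem.1 ht)
      (injective_mirrorXLin (h.trans (map_zero _).symm))
  lowerArc_zero := by simp [b.lowerArc_one]
  lowerArc_one := by simp [b.lowerArc_zero]
  upperArc_zero := by simp [b.upperArc_one]
  upperArc_one := by simp [b.upperArc_zero]
  lowerArc_mem t ht := by
    obtain ⟨h1, h2⟩ := b.lowerArc_mem (1 - t) (Set.Ioo.mem_iff_one_sub_mem.1 ht)
    exact ⟨mirrorX_mem_squareNhd_iff.2 h1, by rwa [mirrorX_apply_one]⟩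
  upperArc_mem t ht := by
    obtain ⟨h1, h2⟩ := b.upperArc_mem (1 - t) (Set.Ioo.mem_iff_one_sub_mem.1 ht)
    exact ⟨mirrorX_mem_squareNhd_iff.2 h1, by rwa [mirrorX_apply_one]⟩
  preimage_range := by
    rw [Knot.range_reverse]
    ext x
    have h := Set.ext_iff.mp b.preimage_range (mirrorX x)
    simp only [mem_inter_iff, mem_preimage, mirrorX_mem_squareNhd_iff, mem_union] at h ⊢
    rw [h, mem_image_mirrorX_comp_iff fun _ ↦ Set.Ioo.mem_iff_one_sub_mem,
      mem_image_mirrorX_comp_iff fun _ ↦ Set.Ioo.mem_iff_one_sub_mem]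
  orient_left := by
    obtain ⟨θ, c, hc, hpt, hder⟩ := b.orient_right
    refine ⟨-θ, c, hc, ?_, ?_⟩
    · rw [Knot.reverse_apply_circlePoint', neg_neg, hpt, mirrorX_pt2]
      norm_num
    · rw [Knot.deriv_coe_reverse_circlePoint, neg_neg, hder, fderiv_coe_band_mirrorX, mirrorX_pt2,
        ← smul_neg, ← map_neg]
      congr 2
      · norm_num
      · ext i; fin_cases i <;> simp [pt2]
  orient_right := by
    obtain ⟨θ, c, hc, hpt, hder⟩ := b.orient_left
    refine ⟨-θ, c, hc, ?_, ?_⟩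
    · rw [Knot.reverse_apply_circlePoint', neg_neg, hpt, mirrorX_pt2]
      norm_num
    · rw [Knot.deriv_coe_reverse_circlePoint, neg_neg, hder, fderiv_coe_band_mirrorX, mirrorX_pt2,
        ← smul_neg, ← map_neg]
      congr 2
      · norm_num
      · ext i; fin_cases i <;> simp [pt2]
  orient_result := by
    obtain ⟨θ, c, hc, hpt, hder⟩ := b.orient_result
    refine ⟨-θ, c, hc, ?_, ?_⟩
    · rw [Knot.reverse_apply_circlePoint', neg_neg, hpt]
      norm_num
    · rw [Knot.deriv_coe_reverse_circlePoint, neg_neg, hder, fderiv_coe_band_mirrorX, mirrorX_mirrorX,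
        deriv_mirrorX_comp_one_sub b.contDiff_lowerArc, map_neg, mirrorXLin_mirrorXLin, map_neg, smul_neg]
      norm_num

/-- The band of the reverse–mirror. [folklore] -/
@[simp]
theorem reverseMirror_band : b.reverseMirror.band = fun x ↦ b.band (mirrorX x) := rfl

/-- The collar width of the reverse–mirror. [folklore] -/
@[simp]
theorem reverseMirror_δ : b.reverseMirror.δ = b.δ := rfl

/-- The lower arc of the reverse–mirror. [folklore] -/
@[simp]
theorem reverseMirror_lowerArc : b.reverseMirror.lowerArc = fun s ↦ mirrorX (b.lowerArc (1 - s)) := rfl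

/-- The upper arc of the reverse–mirror. [folklore] -/
@[simp]
theorem reverseMirror_upperArc : b.reverseMirror.upperArc = fun s ↦ mirrorX (b.upperArc (1 - s)) := rfl

/-- The band surface of the reverse–mirror is that of `b`. [folklore] -/
@[simp]
theorem reverseMirror_support : b.reverseMirror.support = b.support := by
  show (fun x ↦ b.band (mirrorX x)) '' squareNhd b.δ = b.band '' squareNhd b.δ
  rw [show (fun x ↦ b.band (mirrorX x)) = b.band ∘ mirrorX from rfl, image_comp, image_mirrorX_squareNhd]

/-- The image of the lower arc of the reverse–mirror is the mirrored image of the lower arc.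
[folklore] -/
theorem reverseMirror_lowerArc_image_Icc :
    b.reverseMirror.lowerArc '' Icc 0 1 = mirrorX '' (b.lowerArc '' Icc 0 1) := by
  ext x
  rw [reverseMirror_lowerArc, mem_image_mirrorX_comp_iff fun _ ↦ Set.Icc.mem_iff_one_sub_mem]
  constructor
  · intro h; exact ⟨mirrorX x, h, mirrorX_mirrorX x⟩
  · rintro ⟨y, hy, rfl⟩; rwa [mirrorX_mirrorX]

/-- The image of the upper arc of the reverse–mirror is the mirrored image of the upper arc.
[folklore] -/
theorem reverseMirror_upperArc_image_Icc :
    b.reverseMirror.upperArc '' Icc 0 1 = mirrorX '' (b.upperArc '' Icc 0 1) := by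
  ext x
  rw [reverseMirror_upperArc, mem_image_mirrorX_comp_iff fun _ ↦ Set.Icc.mem_iff_one_sub_mem]
  constructor
  · intro h; exact ⟨mirrorX x, h, mirrorX_mirrorX x⟩
  · rintro ⟨y, hy, rfl⟩; rwa [mirrorX_mirrorX]

/-! ## The half-turn of band-sum data (explicit form of `exists_halfTurn`) -/

/-- **The half-turned band-sum data** (explicit form of the tree's `BandData.exists_halfTurn`,
`BandSumCommProofs.lean`, whose construction this copies): if `K` is the band sum of `K₁`, `K₂`
along `band` and the summands are disjoint, then `K` is the band sum of `K₂`, `K₁` along the band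
precomposed with the half-turn `x ↦ (1, 1) - x`, the new planar arcs being the half-turned old ones
in the other order. Rolfsen (1976), §2.G; Cromwell (2004), §4.6. [folklore] -/
def halfTurn (hdisj : Disjoint (range K₁) (range K₂)) : BandData K₂ K₁ K avoid where
  band x := b.band (pt2 1 1 - x)
  δ := b.δ
  δ_pos := b.δ_pos
  contMDiff := b.contMDiff.comp (contDiff_const.sub contDiff_id).contMDiff
  injOn x hx y hy h := sub_right_injective
    (b.injOn (pt2_one_one_sub_mem_squareNhd_iff.2 hx) (pt2_one_one_sub_mem_squareNhd_iff.2 hy) h)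
  injective_mfderiv x hx := by
    have hρs : ContDiff ℝ ∞ (fun x : 𝔼 2 ↦ pt2 1 1 - x) := contDiff_const.sub contDiff_id
    have hn : (∞ : ℕ∞ω) ≠ 0 := by simp
    have hb : MDifferentiableAt 𝓘(ℝ, 𝔼 2) (𝓡 3) b.band (pt2 1 1 - x) := b.contMDiff.mdifferentiableAt hn
    have hρ : MDifferentiableAt 𝓘(ℝ, 𝔼 2) 𝓘(ℝ, 𝔼 2) (fun x : 𝔼 2 ↦ pt2 1 1 - x) x :=
      hρs.contMDiff.mdifferentiableAt hn
    rw [show (fun x ↦ b.band (pt2 1 1 - x)) = b.band ∘ (fun x : 𝔼 2 ↦ pt2 1 1 - x) from rfl,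
      mfderiv_comp x hb hρ, mfderiv_eq_fderiv, fderiv_const_sub, fderiv_fun_id]
    intro v w hvw
    simp only [ContinuousLinearMap.comp_apply] at hvw
    exact neg_injective (b.injective_mfderiv _ (pt2_one_one_sub_mem_squareNhd_iff.2 hx) hvw)
  disjoint_avoid := by
    rw [show (fun x ↦ b.band (pt2 1 1 - x)) = b.band ∘ (fun x : 𝔼 2 ↦ pt2 1 1 - x) from rfl,
      image_comp, image_pt2_one_one_sub_squareNhd]
    exact b.disjoint_avoid
  preimage_left := by
    ext x
    have h := Set.ext_iff.mp b.preimage_right (pt2 1 1 - x)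
    simp only [mem_inter_iff, mem_preimage, mem_setOf_eq, pt2_one_one_sub_mem_squareNhd_iff,
      pt2_one_one_sub_apply] at h ⊢
    rw [h]
    exact and_congr_right fun _ ↦ ⟨fun h ↦ by linarith, fun h ↦ by linarith⟩
  preimage_right := by
    ext x
    have h := Set.ext_iff.mp b.preimage_left (pt2 1 1 - x)
    simp only [mem_inter_iff, mem_preimage, mem_setOf_eq, pt2_one_one_sub_mem_squareNhd_iff,
      pt2_one_one_sub_apply] at h ⊢
    rw [h]
    exact and_congr_right fun _ ↦ ⟨fun h ↦ by linarith, fun h ↦ by linarith⟩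
  range_diff := by
    rw [show (fun x ↦ b.band (pt2 1 1 - x)) = b.band ∘ (fun x : 𝔼 2 ↦ pt2 1 1 - x) from rfl,
      image_comp, image_pt2_one_one_sub_squareNhd, b.range_diff, union_comm]
  lowerArc t := pt2 1 1 - b.upperArc t
  upperArc t := pt2 1 1 - b.lowerArc t
  contDiff_lowerArc := contDiff_const.sub b.contDiff_upperArc
  contDiff_upperArc := contDiff_const.sub b.contDiff_lowerArc
  injOn_lowerArc s hs t ht h := b.injOn_upperArc hs ht (sub_right_injective h)
  injOn_upperArc s hs t ht h := b.injOn_lowerArc hs ht (sub_right_injective h)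
  deriv_lowerArc_ne_zero t ht := by
    rw [deriv_const_sub]
    exact neg_ne_zero.2 (b.deriv_upperArc_ne_zero t ht)
  deriv_upperArc_ne_zero t ht := by
    rw [deriv_const_sub]
    exact neg_ne_zero.2 (b.deriv_lowerArc_ne_zero t ht)
  lowerArc_zero := by
    simp only [b.upperArc_zero, pt2_one_one_sub_pt2]
    norm_num
  lowerArc_one := by
    simp only [b.upperArc_one, pt2_one_one_sub_pt2]
    norm_num
  upperArc_zero := by
    simp only [b.lowerArc_zero, pt2_one_one_sub_pt2]
    norm_num
  upperArc_one := by
    simp only [b.lowerArc_one, pt2_one_one_sub_pt2]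
    norm_num
  lowerArc_mem t ht := by
    obtain ⟨h1, h2⟩ := b.upperArc_mem t ht
    refine ⟨pt2_one_one_sub_mem_squareNhd_iff.2 h1, ?_⟩
    rw [pt2_one_one_sub_apply]
    linarith
  upperArc_mem t ht := by
    obtain ⟨h1, h2⟩ := b.lowerArc_mem t ht
    refine ⟨pt2_one_one_sub_mem_squareNhd_iff.2 h1, ?_⟩
    rw [pt2_one_one_sub_apply]
    linarith
  preimage_range := by
    ext x
    have h := Set.ext_iff.mp b.preimage_range (pt2 1 1 - x)
    simp only [mem_inter_iff, mem_preimage, pt2_one_one_sub_mem_squareNhd_iff, mem_union] at h ⊢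
    rw [h, mem_image_pt2_one_one_sub_comp_iff, mem_image_pt2_one_one_sub_comp_iff, or_comm]
  orient_left := by
    obtain ⟨θ, c, hc, hpt, hder⟩ := b.orient_right
    refine ⟨θ, c, hc, ?_, ?_⟩
    · rw [hpt, pt2_one_one_sub_pt2]
      norm_num
    · rw [hder, fderiv_coe_band_pt2_one_one_sub, pt2_one_one_sub_pt2]
      congr 2 <;> [norm_num; (ext i; fin_cases i <;> simp [pt2])]
  orient_right := by
    obtain ⟨θ, c, hc, hpt, hder⟩ := b.orient_left
    refine ⟨θ, c, hc, ?_, ?_⟩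
    · rw [hpt, pt2_one_one_sub_pt2]
      norm_num
    · rw [hder, fderiv_coe_band_pt2_one_one_sub, pt2_one_one_sub_pt2]
      congr 2 <;> [norm_num; (ext i; fin_cases i <;> simp [pt2])]
  orient_result := by
    obtain ⟨θ, c, hc, hpt, hder⟩ := b.orient_upper hdisj
    refine ⟨θ, c, hc, ?_, ?_⟩
    · rw [hpt, sub_sub_cancel]
    · rw [hder, fderiv_coe_band_pt2_one_one_sub, sub_sub_cancel, deriv_const_sub, neg_neg]

/-- The band of the half-turn. [folklore] -/
@[simp]
theorem halfTurn_band (hdisj : Disjoint (range K₁) (range K₂)) :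
    (b.halfTurn hdisj).band = fun x ↦ b.band (pt2 1 1 - x) := rfl

/-- The collar width of the half-turn. [folklore] -/
@[simp]
theorem halfTurn_δ (hdisj : Disjoint (range K₁) (range K₂)) : (b.halfTurn hdisj).δ = b.δ := rfl

/-- The lower arc of the half-turn is the half-turned upper arc. [folklore] -/
@[simp]
theorem halfTurn_lowerArc (hdisj : Disjoint (range K₁) (range K₂)) :
    (b.halfTurn hdisj).lowerArc = fun t ↦ pt2 1 1 - b.upperArc t := rfl

/-- The upper arc of the half-turn is the half-turned lower arc. [folklore] -/
@[simp]
theorem halfTurn_upperArc (hdisj : Disjoint (range K₁) (range K₂)) :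
    (b.halfTurn hdisj).upperArc = fun t ↦ pt2 1 1 - b.lowerArc t := rfl

/-- The band surface of the half-turn is that of `b`. [folklore] -/
@[simp]
theorem halfTurn_support (hdisj : Disjoint (range K₁) (range K₂)) : (b.halfTurn hdisj).support = b.support := by
  show (fun x ↦ b.band (pt2 1 1 - x)) '' squareNhd b.δ = b.band '' squareNhd b.δ
  rw [show (fun x ↦ b.band (pt2 1 1 - x)) = b.band ∘ (fun x : 𝔼 2 ↦ pt2 1 1 - x) from rfl, image_comp,
    image_pt2_one_one_sub_squareNhd]

/-- The lower arc of the half-turn, on `𝕊³`, is the upper arc of `b`. [folklore] -/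
@[simp]
theorem halfTurn_lowerCurve (hdisj : Disjoint (range K₁) (range K₂)) (s : ℝ) :
    (b.halfTurn hdisj).lowerCurve s = b.upperCurve s := by
  show b.band (pt2 1 1 - (pt2 1 1 - b.upperArc s)) = b.band (b.upperArc s)
  rw [sub_sub_cancel]

/-- The upper arc of the half-turn, on `𝕊³`, is the lower arc of `b`. [folklore] -/
@[simp]
theorem halfTurn_upperCurve (hdisj : Disjoint (range K₁) (range K₂)) (s : ℝ) :
    (b.halfTurn hdisj).upperCurve s = b.lowerCurve s := by
  show b.band (pt2 1 1 - (pt2 1 1 - b.lowerArc s)) = b.band (b.lowerArc s)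
  rw [sub_sub_cancel]

/-- The lower arc of the reverse–mirror, on `𝕊³`, is the lower arc of `b` traversed backwards.
[folklore] -/
@[simp]
theorem reverseMirror_lowerCurve (s : ℝ) : b.reverseMirror.lowerCurve s = b.lowerCurve (1 - s) := by
  show b.band (mirrorX (mirrorX (b.lowerArc (1 - s)))) = b.band (b.lowerArc (1 - s))
  rw [mirrorX_mirrorX]

/-- The upper arc of the reverse–mirror, on `𝕊³`, is the upper arc of `b` traversed backwards.
[folklore] -/
@[simp]
theorem reverseMirror_upperCurve (s : ℝ) : b.reverseMirror.upperCurve s = b.upperCurve (1 - s) := by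
  show b.band (mirrorX (mirrorX (b.upperArc (1 - s)))) = b.band (b.upperArc (1 - s))
  rw [mirrorX_mirrorX]

/-- The image of the lower arc of the half-turn is the half-turned image of the upper arc.
[folklore] -/
theorem halfTurn_lowerArc_image (hdisj : Disjoint (range K₁) (range K₂)) (S : Set ℝ) :
    (b.halfTurn hdisj).lowerArc '' S = (fun x : 𝔼 2 ↦ pt2 1 1 - x) '' (b.upperArc '' S) := by
  rw [halfTurn_lowerArc, ← image_comp]
  rfl

end BandData

/-! ## Precomposing a thickening with a symmetry of the square -/

namespace PatchThickening

variable {β : 𝔼 2 → 𝕊 3} {δ₀ δ₁ : ℝ} (T : PatchThickening β δ₀ δ₁)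

/-- **Precomposition of a thickening with an involutive symmetry of the collar squares.** If
`A : ℝ² → ℝ²` is a smooth involution preserving every `squareNhd δ`, a thickening `T` of the patch
`β` yields one of `β ∘ A` with the same `emb` and parametrisation `A ∘ param`. [folklore] -/
def precomp {A : 𝔼 2 → 𝔼 2} (hA : ContDiff ℝ ∞ A) (hAA : ∀ x, A (A x) = x)
    (hmaps : ∀ δ x, x ∈ squareNhd δ → A x ∈ squareNhd δ) : PatchThickening (β ∘ A) δ₀ δ₁ where
  emb := T.emb
  param := A ∘ T.param
  isSmoothEmbedding := T.isSmoothEmbedding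
  isOpen_range := T.isOpen_range
  contDiff_param := hA.comp T.contDiff_param
  injective_param := (Function.Involutive.injective hAA).comp T.injective_param
  injective_fderiv_param y := by
    have hAd : ∀ x, HasFDerivAt A (fderiv ℝ A x) x := fun x ↦
      ((hA.differentiable (by simp)) x).hasFDerivAt
    have hinjA : ∀ x, Injective (fderiv ℝ A x) := fun x ↦ by
      have h := ((hAd (A x)).comp x (hAd x)).fderiv
      have hid : fderiv ℝ (A ∘ A) x = ContinuousLinearMap.id ℝ (𝔼 2) := by
        rw [show A ∘ A = id from funext hAA]; exact fderiv_id
      rw [hid] at h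
      intro v w hvw
      have := congrArg (fderiv ℝ A (A x)) hvw
      rw [← ContinuousLinearMap.comp_apply, ← ContinuousLinearMap.comp_apply, ← h] at this
      exact this
    rw [fderiv_comp y ((hA.differentiable (by simp)) _) ((T.contDiff_param.differentiable (by simp)) _)]
    exact (hinjA _).comp (T.injective_fderiv_param y)
  isOpen_range_param := by
    rw [range_comp]
    have hhomeo : IsOpenMap A := by
      have : A = (⟨⟨A, A, hAA, hAA⟩, hA.continuous, hA.continuous⟩ : 𝔼 2 ≃ₜ 𝔼 2) := rfl
      rw [this]; exact Homeomorph.isOpenMap _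
    exact hhomeo _ T.isOpen_range_param
  contDiffOn_invFun_param := by
    have hinj : Injective (A ∘ T.param) := (Function.Involutive.injective hAA).comp T.injective_param
    have heq : EqOn (Function.invFun (A ∘ T.param)) (Function.invFun T.param ∘ A) (range (A ∘ T.param)) := by
      rintro _ ⟨y, rfl⟩
      rw [Function.leftInverse_invFun hinj y]
      show y = Function.invFun T.param (A (A (T.param y)))
      rw [hAA, Function.leftInverse_invFun T.injective_param y]
    refine ContDiffOn.congr ?_ heq
    refine T.contDiffOn_invFun_param.comp hA.contDiffOn ?_
    rintro _ ⟨y, rfl⟩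
    show A (A (T.param y)) ∈ range T.param
    rw [hAA]; exact mem_range_self y
  squareNhd_subset x hx := by
    obtain ⟨y, hy⟩ := T.squareNhd_subset (hmaps δ₁ x hx)
    exact ⟨y, by show A (T.param y) = x; rw [hy, hAA]⟩
  range_param_subset := by
    rintro _ ⟨y, rfl⟩
    exact hmaps δ₀ _ (T.range_param_subset (mem_range_self y))
  emb_inl y := by
    show T.emb (slabEquiv.symm (y, 0)) = β (A (A (T.param y)))
    rw [hAA, T.emb_inl]

/-- The thickening map of the precomposition is that of `T`. [folklore] -/
@[simp]
theorem precomp_emb {A : 𝔼 2 → 𝔼 2} (hA : ContDiff ℝ ∞ A) (hAA : ∀ x, A (A x) = x)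
    (hmaps : ∀ δ x, x ∈ squareNhd δ → A x ∈ squareNhd δ) : (T.precomp hA hAA hmaps).emb = T.emb := rfl

/-- The parametrisation of the precomposition is `A ∘ param`. [folklore] -/
@[simp]
theorem precomp_param {A : 𝔼 2 → 𝔼 2} (hA : ContDiff ℝ ∞ A) (hAA : ∀ x, A (A x) = x)
    (hmaps : ∀ δ x, x ∈ squareNhd δ → A x ∈ squareNhd δ) :
    (T.precomp hA hAA hmaps).param = A ∘ T.param := rfl

/-- The chart of the precomposition is that of `T`. [folklore] -/
@[simp]
theorem precomp_chart {A : 𝔼 2 → 𝔼 2} (hA : ContDiff ℝ ∞ A) (hAA : ∀ x, A (A x) = x)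
    (hmaps : ∀ δ x, x ∈ squareNhd δ → A x ∈ squareNhd δ) :
    (T.precomp hA hAA hmaps).chart = T.chart := rfl

/-- **The half-turned thickening** (for the half-turned band `x ↦ β ((1, 1) - x)`). [folklore] -/
def halfTurn : PatchThickening (β ∘ fun x : 𝔼 2 ↦ pt2 1 1 - x) δ₀ δ₁ :=
  T.precomp (contDiff_const.sub contDiff_id) (fun x ↦ sub_sub_cancel _ x)
    fun _ _ hx ↦ pt2_one_one_sub_mem_squareNhd_iff.2 hx

/-- **The mirrored thickening** (for the mirrored band `β ∘ mirrorX`). [folklore] -/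
def mirror : PatchThickening (β ∘ mirrorX) δ₀ δ₁ :=
  T.precomp contDiff_mirrorX mirrorX_mirrorX fun _ _ hx ↦ mirrorX_mem_squareNhd_iff.2 hx

/-- The planar coordinate of the precomposed thickening is `A` of the planar coordinate.
[folklore] -/
theorem planar_precomp {A : 𝔼 2 → 𝔼 2} (hA : ContDiff ℝ ∞ A) (hAA : ∀ x, A (A x) = x)
    (hmaps : ∀ δ x, x ∈ squareNhd δ → A x ∈ squareNhd δ) (c : 𝕊 3) :
    (T.precomp hA hAA hmaps).planar c = A (T.planar c) := rfl

/-- The planar coordinate of the half-turned thickening. [folklore] -/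
@[simp]
theorem planar_halfTurn (c : 𝕊 3) : T.halfTurn.planar c = pt2 1 1 - T.planar c := rfl

/-- The planar coordinate of the mirrored thickening. [folklore] -/
@[simp]
theorem planar_mirror (c : 𝕊 3) : T.mirror.planar c = mirrorX (T.planar c) := rfl

/-- The thickening map of the half-turned thickening. [folklore] -/
@[simp]
theorem halfTurn_emb : T.halfTurn.emb = T.emb := rfl

/-- The thickening map of the mirrored thickening. [folklore] -/
@[simp]
theorem mirror_emb : T.mirror.emb = T.emb := rfl

end PatchThickening

/-- The mirror is an isometry. [folklore] -/
@[simp]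
theorem dist_mirrorX (x y : 𝔼 2) : dist (mirrorX x) (mirrorX y) = dist x y := by
  simp only [EuclideanSpace.dist_eq, Fin.sum_univ_two, mirrorX_apply_zero, mirrorX_apply_one, Real.dist_eq]
  congr 2
  rw [show 1 - x 0 - (1 - y 0) = -(x 0 - y 0) by ring, abs_neg]

/-- The half-turn is an isometry. [folklore] -/
@[simp]
theorem dist_pt2_one_one_sub (x y : 𝔼 2) : dist (pt2 1 1 - x) (pt2 1 1 - y) = dist x y :=
  dist_sub_left _ _ _

/-! ## The other attaching points, by symmetry -/

namespace BandData

variable {K₁ K₂ K : Knot} {avoid : Set (𝕊 3)} (b : BandData K₁ K₂ K avoid)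
variable {δ₀ δ₁ : ℝ} (T : PatchThickening b.band δ₀ δ₁)

/-- **Near `p' = band (1, -δ)`, points of `K` off the band surface project strictly below the edge
line** (the attaching point where `K` leaves the lower arc along `K₂`): the set form
`exists_radius_planar_one_lt` for the reverse–mirror `b.reverseMirror` (for which `p'` is the
incoming attaching point of `K.reverse` along `K₂.reverse`), read back through the mirrored
thickening. [folklore] -/
theorem exists_radius_planar_one_lt_right (hδ₁ : b.δ < δ₁) (hdisj : Disjoint (range K₁) (range K₂)) :
    ∃ r > 0, ∀ c ∈ range K, dist c (b.band (pt2 1 (-b.δ))) < r → c ∉ b.support →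
      c ≠ b.band (pt2 1 (-b.δ)) → c ∈ range T.emb ∧ T.planar c 1 < -b.δ := by
  have hdisj' : Disjoint (range (K₂.reverse : Knot)) (range (K₁.reverse : Knot)) := by
    rw [Knot.range_reverse, Knot.range_reverse]; exact hdisj.symm
  obtain ⟨r, hr, h⟩ := b.reverseMirror.exists_radius_planar_one_lt T.mirror hδ₁ hdisj'
  refine ⟨r, hr, fun c hc hdist hsupp hne ↦ ?_⟩
  have hp : b.reverseMirror.band (pt2 0 (-b.reverseMirror.δ)) = b.band (pt2 1 (-b.δ)) := by
    simp
  rw [hp, reverseMirror_support, Knot.range_reverse] at h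
  obtain ⟨hmem, hlt⟩ := h c hc hdist hsupp hne
  have hlt' : mirrorX (T.planar c) 1 < -b.δ := hlt
  exact ⟨hmem, hlt'⟩

include T in
/-- **Near `B = (1, -δ)` the planar lower arc is the graph `x₀ = 1 - g (x₁)`, `x₁ ≥ -δ`, of a
`C^∞` function `g` vanishing on `(-∞, -δ]`** (flatness of the lower arc at its endpoint on `K₂`):
`exists_flat_graph_lowerArc_left` for the reverse–mirror, read back through the mirror (an isometry
exchanging `A` and `B` and carrying the lower arc onto the reversed lower arc). [folklore] -/
theorem exists_flat_graph_lowerArc_right (hδ₁ : b.δ < δ₁) (hdisj : Disjoint (range K₁) (range K₂)) :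
    ∃ g : ℝ → ℝ, ContDiff ℝ ∞ g ∧ (∀ y ≤ -b.δ, g y = 0) ∧ ∃ ε > 0, ∀ x : 𝔼 2,
      dist x (pt2 1 (-b.δ)) < ε → (x ∈ b.lowerArc '' Icc 0 1 ↔ -b.δ ≤ x 1 ∧ x 0 = 1 - g (x 1)) := by
  have hdisj' : Disjoint (range (K₂.reverse : Knot)) (range (K₁.reverse : Knot)) := by
    rw [Knot.range_reverse, Knot.range_reverse]; exact hdisj.symm
  obtain ⟨g, hg, hg0, ε, hε, h⟩ := b.reverseMirror.exists_flat_graph_lowerArc_left T.mirror hδ₁ hdisj'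
  refine ⟨g, hg, hg0, ε, hε, fun x hx ↦ ?_⟩
  have hx' : dist (mirrorX x) (pt2 0 (-b.reverseMirror.δ)) < ε := by
    rw [reverseMirror_δ, show pt2 0 (-b.δ) = mirrorX (pt2 1 (-b.δ)) by simp, dist_mirrorX]; exact hx
  have key := h (mirrorX x) hx'
  rw [reverseMirror_lowerArc_image_Icc, mirrorX_apply_zero, mirrorX_apply_one, reverseMirror_δ] at key
  rw [show (x ∈ b.lowerArc '' Icc 0 1) ↔ mirrorX x ∈ mirrorX '' (b.lowerArc '' Icc 0 1) from
    ⟨fun hx ↦ ⟨x, hx, rfl⟩, fun ⟨y, hy, hxy⟩ ↦ by rwa [← injective_mirrorX hxy]⟩, key]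
  constructor <;> rintro ⟨h1, h2⟩ <;> exact ⟨h1, by linarith⟩

/-- **Near `q' = band (1, 1 + δ)`, points of `K` off the band surface project strictly above the
upper edge line `x₁ = 1 + δ`** (the attaching point where `K` arrives along `K₂` at the upper
arc): `exists_radius_planar_one_lt` for the half-turned data `b.halfTurn`, read back through the
half-turned thickening. [folklore] -/
theorem exists_radius_planar_one_gt_upperRight (hδ₁ : b.δ < δ₁) (hdisj : Disjoint (range K₁) (range K₂)) :
    ∃ r > 0, ∀ c ∈ range K, dist c (b.band (pt2 1 (1 + b.δ))) < r → c ∉ b.support →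
      c ≠ b.band (pt2 1 (1 + b.δ)) → c ∈ range T.emb ∧ 1 + b.δ < T.planar c 1 := by
  obtain ⟨r, hr, h⟩ := (b.halfTurn hdisj).exists_radius_planar_one_lt T.halfTurn hδ₁ hdisj.symm
  refine ⟨r, hr, fun c hc hdist hsupp hne ↦ ?_⟩
  have hp : (b.halfTurn hdisj).band (pt2 0 (-(b.halfTurn hdisj).δ)) = b.band (pt2 1 (1 + b.δ)) := by
    simp only [halfTurn_band, halfTurn_δ, pt2_one_one_sub_pt2]
    norm_num
  rw [hp, halfTurn_support] at h
  obtain ⟨hmem, hlt⟩ := h c hc hdist hsupp hne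
  refine ⟨hmem, ?_⟩
  have hlt' : (pt2 1 1 - T.planar c) 1 < -b.δ := hlt
  rw [pt2_one_one_sub_apply] at hlt'
  linarith

/-- **Near `q = band (0, 1 + δ)`, points of `K` off the band surface project strictly above the
upper edge line** (the attaching point where `K` leaves the upper arc along `K₁`):
`exists_radius_planar_one_lt_right` for the half-turned data. [folklore] -/
theorem exists_radius_planar_one_gt_upperLeft (hδ₁ : b.δ < δ₁) (hdisj : Disjoint (range K₁) (range K₂)) :
    ∃ r > 0, ∀ c ∈ range K, dist c (b.band (pt2 0 (1 + b.δ))) < r → c ∉ b.support →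
      c ≠ b.band (pt2 0 (1 + b.δ)) → c ∈ range T.emb ∧ 1 + b.δ < T.planar c 1 := by
  obtain ⟨r, hr, h⟩ := (b.halfTurn hdisj).exists_radius_planar_one_lt_right T.halfTurn hδ₁ hdisj.symm
  refine ⟨r, hr, fun c hc hdist hsupp hne ↦ ?_⟩
  have hp : (b.halfTurn hdisj).band (pt2 1 (-(b.halfTurn hdisj).δ)) = b.band (pt2 0 (1 + b.δ)) := by
    simp only [halfTurn_band, halfTurn_δ, pt2_one_one_sub_pt2]
    norm_num
  rw [hp, halfTurn_support] at h
  obtain ⟨hmem, hlt⟩ := h c hc hdist hsupp hne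
  refine ⟨hmem, ?_⟩
  have hlt' : (pt2 1 1 - T.planar c) 1 < -b.δ := hlt
  rw [pt2_one_one_sub_apply] at hlt'
  linarith

end BandData

end Literature.Topology.FourManifolds
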